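import Summits.CriticalPhenomena.PercolationContinuityZ3.Theorems.Transplant.FKConnectivityAllQAntipodalOddConeTable4

/-!
# Connectivity correlation inequalities for `φ_{w,q}`, every `q > 0` — file 64g: THE 23 LEVEL-4 RAYS IN INDICATOR FORM

Support file (`--supports stmt-CriticalPhenomena-4575`), FK sub-lane `prim-bschramm-fk-2` (gen 29); builds on p205010 (kernel theorem,
internal audit signed; external expert review pending).  No definitions, no named facts, no sorries; standard axioms.  Memo
FROM-fk-2-g29-BRIDGE.md §14.

The ray functions `FK.OddCone.ray4 r x y z w` of the level-4 table (file 64b) are Boolean formulas in `decide (· ∈ X)`; the ray THEOREMS of the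
lineage speak `if x ∈ X then 1 else 0` (Theorem U), `if T ⊆ X then 1 else 0` (`AND⁺`, 64c), `if (e₁∈X ∧ e₂∈X) ∨ … then 1 else 0` (`maj₃⁺`, 61z/64d),
`if S₁ ⊆ X ∧ (y ∈ X ∨ z ∈ X) then 1 else 0` (`T1⁺`, 63f/64e).  This file is the dictionary: one rewriting lemma per ray, keyed by `r.val = k`
(robust under `fin_cases`), so that the master file (64h) is a 23-way dispatch `fin_cases r` + `simp only [ray4_val_k]` + the ray theorem.
[cite: Grimmett2006, §3.8 Thm. (3.90) (pp. 61–62); §3.9 (pp. 63–64)]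
-/

noncomputable section

namespace Summit.CriticalPhenomena.PercolationContinuityZ3.Theorems

namespace FK

namespace OddCone

variable {α : Type*} [DecidableEq α] {x y z w : α} {r : Fin 23}

/-- Ray 0: dictator `x` (Theorem U form). [folklore] -/
theorem ray4_val0 (hr : r.val = 0) (X : Finset α) :
    ray4 r x y z w X = if x ∈ X then 1 else 0 := by
  unfold ray4 rayB
  simp only [hr, decide_eq_true_eq]

/-- Ray 1: dictator `y` (Theorem U form). [folklore] -/
theorem ray4_val1 (hr : r.val = 1) (X : Finset α) :
    ray4 r x y z w X = if y ∈ X then 1 else 0 := by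
  unfold ray4 rayB
  simp only [hr, decide_eq_true_eq]

/-- Ray 2: dictator `z` (Theorem U form). [folklore] -/
theorem ray4_val2 (hr : r.val = 2) (X : Finset α) :
    ray4 r x y z w X = if z ∈ X then 1 else 0 := by
  unfold ray4 rayB
  simp only [hr, decide_eq_true_eq]

/-- Ray 3: dictator `w` (Theorem U form). [folklore] -/
theorem ray4_val3 (hr : r.val = 3) (X : Finset α) :
    ray4 r x y z w X = if w ∈ X then 1 else 0 := by
  unfold ray4 rayB
  simp only [hr, decide_eq_true_eq]

/-- Ray 4: `AND(x,y,z,w)` (subset form of 64c). [folklore] -/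
theorem ray4_val4 (hr : r.val = 4) (X : Finset α) :
    ray4 r x y z w X = if ({x, y, z, w} : Finset α) ⊆ X then 1 else 0 := by
  unfold ray4 rayB
  simp only [hr, Bool.and_eq_true, decide_eq_true_eq, Finset.insert_subset_iff, Finset.singleton_subset_iff, and_assoc]

/-- Ray 5: `AND(x,y,z)` (subset form of 64c). [folklore] -/
theorem ray4_val5 (hr : r.val = 5) (X : Finset α) :
    ray4 r x y z w X = if ({x, y, z} : Finset α) ⊆ X then 1 else 0 := by
  unfold ray4 rayB
  simp only [hr, Bool.and_eq_true, decide_eq_true_eq, Finset.insert_subset_iff, Finset.singleton_subset_iff, and_assoc]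

/-- Ray 6: `AND(x,y,w)` (subset form of 64c). [folklore] -/
theorem ray4_val6 (hr : r.val = 6) (X : Finset α) :
    ray4 r x y z w X = if ({x, y, w} : Finset α) ⊆ X then 1 else 0 := by
  unfold ray4 rayB
  simp only [hr, Bool.and_eq_true, decide_eq_true_eq, Finset.insert_subset_iff, Finset.singleton_subset_iff, and_assoc]

/-- Ray 7: `AND(x,z,w)` (subset form of 64c). [folklore] -/
theorem ray4_val7 (hr : r.val = 7) (X : Finset α) :
    ray4 r x y z w X = if ({x, z, w} : Finset α) ⊆ X then 1 else 0 := by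
  unfold ray4 rayB
  simp only [hr, Bool.and_eq_true, decide_eq_true_eq, Finset.insert_subset_iff, Finset.singleton_subset_iff, and_assoc]

/-- Ray 8: `AND(y,z,w)` (subset form of 64c). [folklore] -/
theorem ray4_val8 (hr : r.val = 8) (X : Finset α) :
    ray4 r x y z w X = if ({y, z, w} : Finset α) ⊆ X then 1 else 0 := by
  unfold ray4 rayB
  simp only [hr, Bool.and_eq_true, decide_eq_true_eq, Finset.insert_subset_iff, Finset.singleton_subset_iff, and_assoc]

/-- Ray 9: `maj₃(x,y,z)` (form of 61z/64d). [folklore] -/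
theorem ray4_val9 (hr : r.val = 9) (X : Finset α) :
    ray4 r x y z w X = if (x ∈ X ∧ y ∈ X) ∨ (x ∈ X ∧ z ∈ X) ∨ (y ∈ X ∧ z ∈ X) then 1 else 0 := by
  unfold ray4 rayB
  simp only [hr, Bool.and_eq_true, Bool.or_eq_true, decide_eq_true_eq, or_assoc]

/-- Ray 10: `maj₃(x,y,w)` (form of 61z/64d). [folklore] -/
theorem ray4_val10 (hr : r.val = 10) (X : Finset α) :
    ray4 r x y z w X = if (x ∈ X ∧ y ∈ X) ∨ (x ∈ X ∧ w ∈ X) ∨ (y ∈ X ∧ w ∈ X) then 1 else 0 := by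
  unfold ray4 rayB
  simp only [hr, Bool.and_eq_true, Bool.or_eq_true, decide_eq_true_eq, or_assoc]

/-- Ray 11: `maj₃(x,z,w)` (form of 61z/64d). [folklore] -/
theorem ray4_val11 (hr : r.val = 11) (X : Finset α) :
    ray4 r x y z w X = if (x ∈ X ∧ z ∈ X) ∨ (x ∈ X ∧ w ∈ X) ∨ (z ∈ X ∧ w ∈ X) then 1 else 0 := by
  unfold ray4 rayB
  simp only [hr, Bool.and_eq_true, Bool.or_eq_true, decide_eq_true_eq, or_assoc]

/-- Ray 12: `maj₃(y,z,w)` (form of 61z/64d). [folklore] -/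
theorem ray4_val12 (hr : r.val = 12) (X : Finset α) :
    ray4 r x y z w X = if (y ∈ X ∧ z ∈ X) ∨ (y ∈ X ∧ w ∈ X) ∨ (z ∈ X ∧ w ∈ X) then 1 else 0 := by
  unfold ray4 rayB
  simp only [hr, Bool.and_eq_true, Bool.or_eq_true, decide_eq_true_eq, or_assoc]

/-- Ray 13: `T1 = xy·(z ∨ w)` (form of 63f/64e). [folklore] -/
theorem ray4_val13 (hr : r.val = 13) (X : Finset α) :
    ray4 r x y z w X = if ({x, y} : Finset α) ⊆ X ∧ (z ∈ X ∨ w ∈ X) then 1 else 0 := by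
  unfold ray4 rayB
  simp only [hr, Bool.and_eq_true, Bool.or_eq_true, decide_eq_true_eq, Finset.insert_subset_iff, Finset.singleton_subset_iff, and_assoc]

/-- Ray 14: `T1 = xz·(y ∨ w)` (form of 63f/64e). [folklore] -/
theorem ray4_val14 (hr : r.val = 14) (X : Finset α) :
    ray4 r x y z w X = if ({x, z} : Finset α) ⊆ X ∧ (y ∈ X ∨ w ∈ X) then 1 else 0 := by
  unfold ray4 rayB
  simp only [hr, Bool.and_eq_true, Bool.or_eq_true, decide_eq_true_eq, Finset.insert_subset_iff, Finset.singleton_subset_iff, and_assoc]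

/-- Ray 15: `T1 = xw·(y ∨ z)` (form of 63f/64e). [folklore] -/
theorem ray4_val15 (hr : r.val = 15) (X : Finset α) :
    ray4 r x y z w X = if ({x, w} : Finset α) ⊆ X ∧ (y ∈ X ∨ z ∈ X) then 1 else 0 := by
  unfold ray4 rayB
  simp only [hr, Bool.and_eq_true, Bool.or_eq_true, decide_eq_true_eq, Finset.insert_subset_iff, Finset.singleton_subset_iff, and_assoc]

/-- Ray 16: `T1 = yz·(x ∨ w)` (form of 63f/64e). [folklore] -/
theorem ray4_val16 (hr : r.val = 16) (X : Finset α) :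
    ray4 r x y z w X = if ({y, z} : Finset α) ⊆ X ∧ (x ∈ X ∨ w ∈ X) then 1 else 0 := by
  unfold ray4 rayB
  simp only [hr, Bool.and_eq_true, Bool.or_eq_true, decide_eq_true_eq, Finset.insert_subset_iff, Finset.singleton_subset_iff, and_assoc]

/-- Ray 17: `T1 = yw·(x ∨ z)` (form of 63f/64e). [folklore] -/
theorem ray4_val17 (hr : r.val = 17) (X : Finset α) :
    ray4 r x y z w X = if ({y, w} : Finset α) ⊆ X ∧ (x ∈ X ∨ z ∈ X) then 1 else 0 := by
  unfold ray4 rayB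
  simp only [hr, Bool.and_eq_true, Bool.or_eq_true, decide_eq_true_eq, Finset.insert_subset_iff, Finset.singleton_subset_iff, and_assoc]

/-- Ray 18: `T1 = zw·(x ∨ y)` (form of 63f/64e). [folklore] -/
theorem ray4_val18 (hr : r.val = 18) (X : Finset α) :
    ray4 r x y z w X = if ({z, w} : Finset α) ⊆ X ∧ (x ∈ X ∨ y ∈ X) then 1 else 0 := by
  unfold ray4 rayB
  simp only [hr, Bool.and_eq_true, Bool.or_eq_true, decide_eq_true_eq, Finset.insert_subset_iff, Finset.singleton_subset_iff, and_assoc]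

/-- Ray 19: `T2` with hub `x` (= `x·OR ∨ AND`, the serq target's type). [folklore] -/
theorem ray4_val19 (hr : r.val = 19) (X : Finset α) :
    ray4 r x y z w X = if (x ∈ X ∧ (y ∈ X ∨ z ∈ X ∨ w ∈ X)) ∨ (y ∈ X ∧ z ∈ X ∧ w ∈ X) then 1 else 0 := by
  unfold ray4 rayB
  simp only [hr, Bool.and_eq_true, Bool.or_eq_true, decide_eq_true_eq, and_assoc, or_assoc]

/-- Ray 20: `T2` with hub `y` (= `y·OR ∨ AND`, the serq target's type). [folklore] -/
theorem ray4_val20 (hr : r.val = 20) (X : Finset α) :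
    ray4 r x y z w X = if (y ∈ X ∧ (x ∈ X ∨ z ∈ X ∨ w ∈ X)) ∨ (x ∈ X ∧ z ∈ X ∧ w ∈ X) then 1 else 0 := by
  unfold ray4 rayB
  simp only [hr, Bool.and_eq_true, Bool.or_eq_true, decide_eq_true_eq, and_assoc, or_assoc]

/-- Ray 21: `T2` with hub `z` (= `z·OR ∨ AND`, the serq target's type). [folklore] -/
theorem ray4_val21 (hr : r.val = 21) (X : Finset α) :
    ray4 r x y z w X = if (z ∈ X ∧ (x ∈ X ∨ y ∈ X ∨ w ∈ X)) ∨ (x ∈ X ∧ y ∈ X ∧ w ∈ X) then 1 else 0 := by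
  unfold ray4 rayB
  simp only [hr, Bool.and_eq_true, Bool.or_eq_true, decide_eq_true_eq, and_assoc, or_assoc]

/-- Ray 22: `T2` with hub `w` (= `w·OR ∨ AND`, the serq target's type). [folklore] -/
theorem ray4_val22 (hr : r.val = 22) (X : Finset α) :
    ray4 r x y z w X = if (w ∈ X ∧ (x ∈ X ∨ y ∈ X ∨ z ∈ X)) ∨ (x ∈ X ∧ y ∈ X ∧ z ∈ X) then 1 else 0 := by
  unfold ray4 rayB
  simp only [hr, Bool.and_eq_true, Bool.or_eq_true, decide_eq_true_eq, and_assoc, or_assoc]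

end OddCone

end FK

end Summit.CriticalPhenomena.PercolationContinuityZ3.Theorems
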